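import Summits.AtomisticToContinuum.BoseEinsteinCondensation.Theses.BECStronglyRayleigh
import Summits.AtomisticToContinuum.BoseEinsteinCondensation.Theorems.InsertionFieldDelocalisation.Negative.Toolkit
import Literature.Probability.LatticeModels.LatticeGreenFunction
import Literature.Probability.LatticeModels.LatticeGreenRiemannSum
import HarnessLib

/-!
# Stub `stub_torusGreenZeroBounded` (G3) of line `log-insertion-infrared-bound`, crux
# `BECStronglyRayleigh.InsertionFieldDelocalisation` (stmt-AtomisticToContinuum-9673)

**The `d = 3` constant (Watson / Kennedy–Lieb–Shastry).** The massless lattice Green function of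
the three-torus `(ℤ/Lℤ)³` at coinciding points,

  `torusGreen 0 = L⁻³ Σ_{k ≠ 0} 1 / ε(p_k)`,  `ε(p) = Σᵢ (1 − cos pᵢ)`, `p_k = 2π k.val / L`,

is bounded uniformly in the side: `torusGreen 0 ≤ 4` for every `L ≥ 1` (numerically
`torusGreen 0 → W₃ = π⁻³ ∫_{[0,π]³} dp / (3 − cos p₁ − cos p₂ − cos p₃) ≈ 0.5055`, Watson's integral;
any uniform constant serves the line).

Proof (elementary, no limits). For `k ≠ 0` let `mᵢ := ZMod.valMinAbs (k i) ∈ (-L/2, L/2]` be the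
centred representatives, `m ≠ 0`. Since `(k i).val ≡ mᵢ (mod L)`, `cos (p_k)ᵢ = cos (2π mᵢ / L)`
(`2π`-periodicity), and Jordan's inequality `cos x ≤ 1 − (2/π²) x²` on `|x| ≤ π` (Mathlib
`Real.cos_le_one_sub_mul_cos_sq`) gives `1 − cos (p_k)ᵢ ≥ 8 mᵢ² / L²`, whence
`ε(p_k) ≥ (8/L²) Σᵢ mᵢ² ≥ (8/L²) ‖m‖_∞²` and `1/ε(p_k) ≤ (L²/8) ‖m‖_∞⁻²`. The map `k ↦ m` is
injective into the punctured box `{0 < ‖m‖_∞ ≤ L/2} ⊆ ℤ³`, so the tree's shell count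
`sum_box_inv_norm_sq_le` (`Σ_{0<‖m‖_∞≤R} ‖m‖_∞⁻² ≤ 2d 3^{d-1} R^{d-2}`, here `54 · (L/2) ≤ 27 L`)
yields `torusGreen 0 ≤ L⁻³ · (L²/8) · 27 L = 27/8 ≤ 4`. This is the only place on the line where
`d = 3 > 2` enters (`d = 1, 2`: `torusGreen 0 ≍ L`, `log L`).

Pure theorem file (no definitions) serving the lead's skeleton `work/InsertionFieldDelocalisation.lean`;
leans only on proved tree lemmas (`torusGreen`, `sum_box_inv_norm_sq_le`, `mem_box`,
`Site.norm_eq_supNorm`, `Site.exists_natAbs_eq_supNorm`) and Mathlib's `ZMod.valMinAbs` API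
(pattern adapted from `Summit.QuantumFields.QCD.Cruxes.TipNoBinding.PositivityNoLeakSpread.stub_greenBound`,
the `d = 4` analogue).
-/

noncomputable section

open scoped BigOperators
open Literature.MathematicalPhysics.QuantumLattice Literature.Probability.LatticeModels
open Summit.AtomisticToContinuum.BoseEinsteinCondensation.Theorems.InsertionFieldDelocalisation.Negative

namespace Summit.AtomisticToContinuum.BoseEinsteinCondensation.Cruxes.InsertionFieldDelocalisation.LogInsertionInfraredBound

open Finset

/-- The torus Green function at the origin is the punctured momentum average of `1/ε(p_k)`:
`torusGreen 0 = L⁻³ Σ_{k ≠ 0} ε(p_k)⁻¹` (all phases vanish at `z = 0`; local copy of the tree's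
`Literature.Barriers.AtomisticToContinuum.torusGreen_zero_eq`, not imported here). -/
theorem g3bd_torusGreen_zero_eq (L : ℕ) [NeZero L] :
    torusGreen (0 : TorusSite 3 L) =
      (∑ k ∈ (univ : Finset (TorusSite 3 L)).erase 0, 1 / dispersion (latticeMomentum L k)) /
        (L : ℝ) ^ 3 := by
  rw [torusGreen]
  congr 1
  refine sum_congr rfl fun k _ => ?_
  simp

/-- `cos (p_k)ᵢ = cos (2π mᵢ / L)` for the centred representative `mᵢ = valMinAbs (k i)`
(`(k i).val = mᵢ` or `(k i).val = mᵢ + L`). -/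
theorem g3bd_cos_latticeMomentum (L : ℕ) [NeZero L] (k : TorusSite 3 L) (i : Fin 3) :
    Real.cos (latticeMomentum L k i) = Real.cos (2 * Real.pi / L * ((k i).valMinAbs : ℝ)) := by
  have hL : (L : ℝ) ≠ 0 := by exact_mod_cast NeZero.ne L
  rw [show latticeMomentum L k i = 2 * Real.pi * ((k i).val : ℝ) / L from rfl]
  have hv := ZMod.val_eq_ite_valMinAbs (k i)
  split_ifs at hv with hc
  · have hv2 : ((k i).val : ℤ) = (k i).valMinAbs := by simpa using hv
    have hv' : ((k i).val : ℝ) = ((k i).valMinAbs : ℝ) := by exact_mod_cast hv2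
    rw [hv']
    ring_nf
  · have hv' : ((k i).val : ℝ) = ((k i).valMinAbs : ℝ) + L := by exact_mod_cast hv
    rw [hv', show 2 * Real.pi * (((k i).valMinAbs : ℝ) + L) / L =
      2 * Real.pi / L * ((k i).valMinAbs : ℝ) + 2 * Real.pi by field_simp, Real.cos_add_two_pi]

/-- **Jordan's bound per coordinate**: `8 mᵢ² / L² ≤ 1 − cos (p_k)ᵢ`, `mᵢ = valMinAbs (k i)`,
because `|2π mᵢ / L| ≤ π` and `cos x ≤ 1 − (2/π²) x²` there. -/
theorem g3bd_coord (L : ℕ) [NeZero L] (k : TorusSite 3 L) (i : Fin 3) :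
    8 * ((k i).valMinAbs : ℝ) ^ 2 / (L : ℝ) ^ 2 ≤ 1 - Real.cos (latticeMomentum L k i) := by
  have hL : (0 : ℝ) < L := by exact_mod_cast Nat.pos_of_ne_zero (NeZero.ne L)
  rw [g3bd_cos_latticeMomentum]
  have hb := ZMod.valMinAbs_mem_Ioc (k i)
  have hlo : -(L : ℝ) < 2 * ((k i).valMinAbs : ℝ) := by
    have h : (-(L : ℤ) : ℝ) < (((k i).valMinAbs * 2 : ℤ) : ℝ) := by exact_mod_cast hb.1
    push_cast at h
    linarith
  have hhi : 2 * ((k i).valMinAbs : ℝ) ≤ L := by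
    have h : (((k i).valMinAbs * 2 : ℤ) : ℝ) ≤ ((L : ℤ) : ℝ) := by exact_mod_cast hb.2
    push_cast at h
    linarith
  have hθ : |2 * Real.pi / L * ((k i).valMinAbs : ℝ)| ≤ Real.pi := by
    rw [abs_le]
    constructor
    · rw [div_mul_eq_mul_div, le_div_iff₀ hL]
      nlinarith [Real.pi_pos]
    · rw [div_mul_eq_mul_div, div_le_iff₀ hL]
      nlinarith [Real.pi_pos]
  have hj := Real.cos_le_one_sub_mul_cos_sq hθ
  have heq : 2 / Real.pi ^ 2 * (2 * Real.pi / L * ((k i).valMinAbs : ℝ)) ^ 2 =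
      8 * ((k i).valMinAbs : ℝ) ^ 2 / (L : ℝ) ^ 2 := by
    field_simp
    ring
  rw [← heq]
  linarith

/-- `‖n‖_∞² ≤ Σᵢ nᵢ²` for `n ∈ ℤ³` (the sup norm is attained at some coordinate). -/
theorem g3bd_norm_sq_le_sum (n : Site 3) : ‖n‖ ^ 2 ≤ ∑ i, ((n i : ℤ) : ℝ) ^ 2 := by
  obtain ⟨i, hi⟩ := Site.exists_natAbs_eq_supNorm Finset.univ_nonempty n
  have hn : ‖n‖ ^ 2 = ((n i : ℤ) : ℝ) ^ 2 := by
    rw [Site.norm_eq_supNorm, ← hi, Nat.cast_natAbs, Int.cast_abs, sq_abs]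
  rw [hn]
  exact Finset.single_le_sum (f := fun j => ((n j : ℤ) : ℝ) ^ 2) (fun j _ => sq_nonneg _)
    (Finset.mem_univ i)

/-- **Termwise bound**: for `k ≠ 0`, `1/ε(p_k) ≤ (L²/8) ‖m(k)‖_∞⁻²` with `m(k)ᵢ = valMinAbs (k i)`. -/
theorem g3bd_term (L : ℕ) [NeZero L] {k : TorusSite 3 L} (hk : k ≠ 0) :
    1 / dispersion (latticeMomentum L k) ≤
      (L : ℝ) ^ 2 / 8 * (‖(fun i => (k i).valMinAbs : Site 3)‖ ^ 2)⁻¹ := by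
  have hL : (0 : ℝ) < L := by exact_mod_cast Nat.pos_of_ne_zero (NeZero.ne L)
  set n : Site 3 := fun i => (k i).valMinAbs with hn
  -- `n ≠ 0`
  have hn0 : n ≠ 0 := by
    intro h
    apply hk
    funext i
    have hi : n i = 0 := by rw [h]; rfl
    exact (ZMod.valMinAbs_eq_zero (k i)).1 hi
  have hnpos : 0 < ‖n‖ ^ 2 := by
    have := norm_pos_iff.2 hn0
    positivity
  -- `(8/L²) ‖n‖² ≤ ε(p_k)`
  have hε : 8 / (L : ℝ) ^ 2 * ‖n‖ ^ 2 ≤ dispersion (latticeMomentum L k) :=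
    calc 8 / (L : ℝ) ^ 2 * ‖n‖ ^ 2 ≤ 8 / (L : ℝ) ^ 2 * ∑ i, ((n i : ℤ) : ℝ) ^ 2 := by
          gcongr
          exact g3bd_norm_sq_le_sum n
      _ = ∑ i, 8 * (((k i).valMinAbs : ℤ) : ℝ) ^ 2 / (L : ℝ) ^ 2 := by
          rw [Finset.mul_sum]
          refine Finset.sum_congr rfl fun i _ => ?_
          rw [hn]
          ring
      _ ≤ ∑ i, (1 - Real.cos (latticeMomentum L k i)) :=
          Finset.sum_le_sum fun i _ => g3bd_coord L k i
      _ = dispersion (latticeMomentum L k) := rfl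
  have hpos : 0 < 8 / (L : ℝ) ^ 2 * ‖n‖ ^ 2 := by positivity
  calc 1 / dispersion (latticeMomentum L k)
      ≤ 1 / (8 / (L : ℝ) ^ 2 * ‖n‖ ^ 2) := one_div_le_one_div_of_le hpos hε
    _ = (L : ℝ) ^ 2 / 8 * (‖n‖ ^ 2)⁻¹ := by
          field_simp

/-- **The punctured momentum sum**: `Σ_{k ≠ 0} 1/ε(p_k) ≤ (27/8) L³` on the dual of `(ℤ/Lℤ)³`
(termwise Jordan bound `g3bd_term`, injectivity of the centred representatives
`k ↦ (valMinAbs (k i))ᵢ` into the punctured box `{0 < ‖m‖_∞ ≤ L/2}`, and the shell count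
`sum_box_inv_norm_sq_le` with `d = 3`: `Σ_{0<‖m‖_∞≤R} ‖m‖_∞⁻² ≤ 54 R`). -/
theorem g3bd_sum_inv_dispersion_le (L : ℕ) [NeZero L] :
    ∑ k ∈ (univ : Finset (TorusSite 3 L)).erase 0, 1 / dispersion (latticeMomentum L k) ≤
      27 / 8 * (L : ℝ) ^ 3 := by
  have hL : (0 : ℝ) < L := by exact_mod_cast Nat.pos_of_ne_zero (NeZero.ne L)
  -- the centred representatives
  set m : TorusSite 3 L → Site 3 := fun k i => (k i).valMinAbs with hm
  set s : Finset (TorusSite 3 L) := (univ : Finset (TorusSite 3 L)).erase 0 with hs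
  have hinj : Set.InjOn m ↑s := by
    intro k _ k' _ hkk'
    funext i
    have h : m k i = m k' i := by rw [hkk']
    exact ZMod.injective_valMinAbs h
  -- the image lies in the punctured box of radius `L/2`
  have hsub : s.image m ⊆ (box 3 (L / 2)).erase 0 := by
    intro n hn
    rw [Finset.mem_image] at hn
    obtain ⟨k, hk, rfl⟩ := hn
    rw [hs, Finset.mem_erase] at hk
    rw [Finset.mem_erase]
    constructor
    · intro h
      apply hk.1
      funext i
      have hi : m k i = 0 := by rw [h]; rfl
      exact (ZMod.valMinAbs_eq_zero (k i)).1 hi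
    · rw [mem_box]
      intro i
      have h := ZMod.natAbs_valMinAbs_le (k i)
      change -((L / 2 : ℕ) : ℤ) ≤ (k i).valMinAbs ∧ (k i).valMinAbs ≤ ((L / 2 : ℕ) : ℤ)
      omega
  -- termwise Jordan bound, then reindex by the injective map `m`
  have h1 : ∑ k ∈ s, 1 / dispersion (latticeMomentum L k) ≤
      ∑ k ∈ s, (L : ℝ) ^ 2 / 8 * (‖m k‖ ^ 2)⁻¹ := by
    refine Finset.sum_le_sum fun k hk => ?_
    rw [hs, Finset.mem_erase] at hk
    exact g3bd_term L hk.1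
  have h2 : ∑ k ∈ s, (L : ℝ) ^ 2 / 8 * (‖m k‖ ^ 2)⁻¹ =
      (L : ℝ) ^ 2 / 8 * ∑ n ∈ s.image m, (‖n‖ ^ 2)⁻¹ := by
    rw [Finset.sum_image hinj, Finset.mul_sum]
  have h3 : ∑ n ∈ s.image m, (‖n‖ ^ 2)⁻¹ ≤ ∑ n ∈ (box 3 (L / 2)).erase 0, (‖n‖ ^ 2)⁻¹ :=
    Finset.sum_le_sum_of_subset_of_nonneg hsub fun n _ _ => by positivity
  -- the shell count in `d = 3`
  have h4 : ∑ n ∈ (box 3 (L / 2)).erase 0, (‖n‖ ^ 2)⁻¹ ≤ 54 * ((L / 2 : ℕ) : ℝ) := by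
    have h := sum_box_inv_norm_sq_le 3 le_rfl (L / 2)
    norm_num at h
    exact h
  have hR : ((L / 2 : ℕ) : ℝ) ≤ (L : ℝ) / 2 := Nat.cast_div_le
  calc ∑ k ∈ s, 1 / dispersion (latticeMomentum L k)
      ≤ (L : ℝ) ^ 2 / 8 * (54 * ((L : ℝ) / 2)) := by
        rw [h2] at h1
        refine h1.trans ?_
        gcongr
        exact h3.trans (h4.trans (by gcongr))
    _ = 27 / 8 * (L : ℝ) ^ 3 := by ring

/-- **G3 · THE `d = 3` CONSTANT** (registered stub `stub_torusGreenZeroBounded` of line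
`log-insertion-infrared-bound`): the torus Green function of `(ℤ/Lℤ)³` at the origin,
`torusGreen 0 = L⁻³ Σ_{k ≠ 0} 1/ε(p_k)`, is bounded uniformly in the side `L ≥ 2`; in fact
`torusGreen 0 ≤ 27/8 ≤ 4` for every `L ≥ 1` (`g3bd_sum_inv_dispersion_le`). -/
theorem stub_torusGreenZeroBounded :
    ∃ C : ℝ, ∀ (L : ℕ) [NeZero L], 2 ≤ L → torusGreen (0 : TorusSite 3 L) ≤ C := by
  refine ⟨4, fun L _ _ => ?_⟩
  have hL : (0 : ℝ) < L := by exact_mod_cast Nat.pos_of_ne_zero (NeZero.ne L)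
  rw [g3bd_torusGreen_zero_eq, div_le_iff₀ (by positivity)]
  calc ∑ k ∈ (univ : Finset (TorusSite 3 L)).erase 0, 1 / dispersion (latticeMomentum L k)
      ≤ 27 / 8 * (L : ℝ) ^ 3 := g3bd_sum_inv_dispersion_le L
    _ ≤ 4 * (L : ℝ) ^ 3 := by nlinarith [pow_pos hL 3]

end Summit.AtomisticToContinuum.BoseEinsteinCondensation.Cruxes.InsertionFieldDelocalisation.LogInsertionInfraredBound
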